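import Mathlib
import Literature.Combinatorics.StablePolynomials.Basic
import HarnessLib

/-!
# Real stable multi-affine polynomials satisfy the Rayleigh inequalities everywhere

Topic `Literature/Combinatorics/StablePolynomials`.  We prove the direction (2) ⇒ (1) of
**Brändén 2007, Theorem 5.6**: if `f ∈ ℝ[z₁,…,zₙ]` is multi-affine and real stable then
`Δᵢⱼ(f)(x) = ∂ᵢf(x)·∂ⱼf(x) − ∂ᵢ∂ⱼf(x)·f(x) ≥ 0` for ALL real points `x ∈ ℝⁿ` and all `i, j`
(`rayleighDiff_nonneg_of_isRealStable`; the tree vendors the equivalence as the named fact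
`Branden2007_multiAffine_rayleighDiff_nonneg_iff_realStable` and uses only (1) ⇒ (2)).

Proof (self-contained, no Hurwitz): for `i = j` multi-affinity gives `∂ᵢ∂ᵢ f = 0`.  For `i ≠ j`
put `A = f(x)`, `B = ∂ᵢf(x)`, `C = ∂ⱼf(x)`, `D = ∂ᵢ∂ⱼf(x)` and suppose `BC − AD < 0`.  By
multi-affinity, `f(w + I eᵢ + t eⱼ) = f(w + I eᵢ) + t·∂ⱼf(w + I eᵢ)` for all complex `w, t`
(`eval_add_single_eq`).  At the real base point `x`, `f(x + I eᵢ) = A + B I` and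
`∂ⱼf(x + I eᵢ) = C + D I ≠ 0`, and `t₀ := −(A + B I)/(C + D I)` has `Im t₀ = (AD − BC)/(C² + D²) > 0`.
Perturbing the base point to `x + iε𝟙 ∈ Hⁿ` and letting `ε → 0⁺`, the corresponding root
`t_ε → t₀` still has positive imaginary part for small `ε`, producing a zero of `f` in `Hⁿ` —
contradicting stability.

## Mathlib / tree search

REUSED: `IsRealStable`, `IsMultiAffine`, `rayleighDiff` (tree, `Basic.lean`); Mathlib
`MvPolynomial.coeff_pderiv`, `MvPolynomial.pderiv_monomial`, `MvPolynomial.degreeOf_le_iff`,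
`MvPolynomial.continuous_eval`, `Filter.Tendsto.div`.  Nothing on Rayleigh differences of stable
polynomials exists in Mathlib (`lean search "rayleighDiff|Rayleigh"`: tree only).

## References

* [Branden2007] P. Brändén, *Polynomials with the half-plane property and matroid theory*,
  Adv. Math. 216 (2007) 302–320 (arXiv:math/0605678), §5, Theorem 5.6.
-/

noncomputable section

namespace Literature.Combinatorics.StablePolynomials

open MvPolynomial Finset Filter Topology
open scoped BigOperators

variable {σ : Type*}

/-! ### Multi-affine polynomials are affine along coordinate lines -/

section CoordLine

variable {R : Type*} [CommSemiring R]

/-- A monomial of degree `≤ 1` in `zᵢ` is affine along the `zᵢ`-line, with slope its `∂ᵢ`: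
`m(w + s eᵢ) = m(w) + s · (∂ᵢ m)(w)`. [folklore] -/
theorem eval_add_single_monomial [DecidableEq σ] {m : σ →₀ ℕ} {i : σ} (hm : m i ≤ 1) (c : R)
    (w : σ → R) (s : R) :
    eval (w + Pi.single i s) (monomial m c) =
      eval w (monomial m c) + s * eval w (pderiv i (monomial m c)) := by
  rcases Nat.le_one_iff_eq_zero_or_eq_one.mp hm with h0 | h1
  · -- `zᵢ` does not occur
    have hpd : pderiv i (monomial m c) = 0 := by
      rw [pderiv_monomial, h0]; simp
    rw [hpd, map_zero, mul_zero, add_zero, eval_monomial, eval_monomial]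
    congr 1
    refine Finsupp.prod_congr fun k hk => ?_
    have hki : k ≠ i := by
      rintro rfl
      rw [Finsupp.mem_support_iff] at hk
      exact hk h0
    simp [Pi.single_eq_of_ne hki]
  · -- `zᵢ` occurs exactly once: split off `X i`
    set m' : σ →₀ ℕ := m - Finsupp.single i 1 with hm'
    have hmm' : m = m' + Finsupp.single i 1 := by
      ext k
      simp only [hm', Finsupp.coe_add, Finsupp.coe_tsub, Pi.add_apply, Pi.sub_apply,
        Finsupp.single_apply]
      split_ifs with hik
      · subst hik; omega
      · omega
    have hm'i : m' i = 0 := by simp [hm', h1]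
    have hsplit : monomial m c = monomial m' c * X i := by
      rw [hmm', X, monomial_mul, mul_one]
    have hpd : pderiv i (monomial m c) = monomial m' c := by
      rw [pderiv_monomial, ← hm', h1]; simp
    -- the `X i`-free factor takes the same value at `w` and `w + s eᵢ`
    have hfree : eval (w + Pi.single i s) (monomial m' c) = eval w (monomial m' c) := by
      rw [eval_monomial, eval_monomial]
      congr 1
      refine Finsupp.prod_congr fun k hk => ?_
      have hki : k ≠ i := by
        rintro rfl
        rw [Finsupp.mem_support_iff] at hk
        exact hk hm'i
      simp [Pi.single_eq_of_ne hki]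
    rw [hpd, hsplit, map_mul, map_mul, hfree, eval_X, eval_X]
    simp only [Pi.add_apply, Pi.single_eq_same]
    ring

/-- **Multi-affine polynomials are affine along coordinate lines**: if `deg_{zᵢ} g ≤ 1` then
`g(w + s eᵢ) = g(w) + s · ∂ᵢg(w)` (over any commutative semiring). [folklore] -/
theorem eval_add_single_eq [DecidableEq σ] {g : MvPolynomial σ R} {i : σ} (hg : g.degreeOf i ≤ 1)
    (w : σ → R) (s : R) :
    eval (w + Pi.single i s) g = eval w g + s * eval w (pderiv i g) := by
  have hsupp : ∀ m ∈ g.support, m i ≤ 1 := fun m hm => (degreeOf_le_iff.mp hg) m hm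
  conv_lhs => rw [g.as_sum]
  conv_rhs => rw [g.as_sum]
  rw [map_sum, map_sum, map_sum, map_sum, Finset.mul_sum, ← Finset.sum_add_distrib]
  exact Finset.sum_congr rfl fun m hm => eval_add_single_monomial (hsupp m hm) _ w s

/-- `deg_{zⱼ} ∂ᵢ g ≤ deg_{zⱼ} g`. [folklore] -/
theorem degreeOf_pderiv_le' (i j : σ) (g : MvPolynomial σ R) :
    (pderiv i g).degreeOf j ≤ g.degreeOf j := by
  classical
  rw [degreeOf_le_iff]
  intro m hm
  have hm' : m + Finsupp.single i 1 ∈ g.support := by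
    rw [mem_support_iff] at hm ⊢
    rw [coeff_pderiv] at hm
    exact fun h => hm (by rw [h, zero_mul])
  have h := (degreeOf_le_iff.mp (le_refl (g.degreeOf j))) _ hm'
  have : m j ≤ (m + Finsupp.single i 1 : σ →₀ ℕ) j := by
    rw [Finsupp.add_apply]; exact Nat.le_add_right _ _
  exact this.trans h

/-- Partial derivatives of a multi-affine polynomial are multi-affine. [folklore] -/
theorem isMultiAffine_pderiv {g : MvPolynomial σ R} (hg : IsMultiAffine g) (i : σ) :
    IsMultiAffine (pderiv i g) :=
  fun j => (degreeOf_pderiv_le' i j g).trans (hg j)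

/-- A multi-affine polynomial has `∂ᵢ∂ᵢ g = 0`. [folklore] -/
theorem pderiv_pderiv_self_of_isMultiAffine {g : MvPolynomial σ R} (hg : IsMultiAffine g)
    (i : σ) : pderiv i (pderiv i g) = 0 := by
  classical
  ext m
  rw [coeff_pderiv, coeff_pderiv, coeff_zero]
  have hdeg : (pderiv i g).degreeOf i = 0 := by
    -- `deg_{zᵢ} ∂ᵢ g ≤ deg_{zᵢ} g - 1 ≤ 0`
    refine Nat.eq_zero_of_le_zero ?_
    rw [degreeOf_le_iff]
    intro m' hm'
    have hm'' : m' + Finsupp.single i 1 ∈ g.support := by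
      rw [mem_support_iff] at hm' ⊢
      rw [coeff_pderiv] at hm'
      exact fun h => hm' (by rw [h, zero_mul])
    have h := (degreeOf_le_iff.mp (hg i)) _ hm''
    rw [Finsupp.add_apply, Finsupp.single_eq_same] at h
    omega
  by_cases hmem : m + Finsupp.single i 1 ∈ (pderiv i g).support
  · have h := (degreeOf_le_iff.mp hdeg.le) _ hmem
    rw [Finsupp.add_apply, Finsupp.single_eq_same] at h
    omega
  · rw [notMem_support_iff] at hmem
    rw [coeff_pderiv] at hmem
    rw [hmem, zero_mul]

/-- Complexification keeps multi-affinity. [folklore] -/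
theorem isMultiAffine_map_algebraMap {g : MvPolynomial σ ℝ} (hg : IsMultiAffine g) :
    IsMultiAffine (MvPolynomial.map (algebraMap ℝ ℂ) g) := by
  intro j
  refine le_trans ?_ (hg j)
  classical
  rw [degreeOf_le_iff]
  intro m hm
  exact (degreeOf_le_iff.mp le_rfl) m (support_map_subset _ _ hm)

end CoordLine

/-! ### Rayleigh differences of real stable multi-affine polynomials -/

section Rayleigh

variable [DecidableEq σ]

omit [DecidableEq σ] in
/-- Evaluation of the complexification at a real vector (local copy of the folklore bridge).
[folklore] -/
theorem eval_map_algebraMap_ofReal (g : MvPolynomial σ ℝ) (y : σ → ℝ) :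
    eval (fun k => (y k : ℂ)) (MvPolynomial.map (algebraMap ℝ ℂ) g) = ((eval y g : ℝ) : ℂ) := by
  induction g using MvPolynomial.induction_on with
  | C a => simp
  | add p q hp hq => simp only [map_add, hp, hq, Complex.ofReal_add]
  | mul_X p k hp => simp only [map_mul, hp, map_X, eval_X, Complex.ofReal_mul]

/-- At `ε = 0` the perturbed point `x + iε𝟙 + I eⱼ` is the real point shifted by `I eⱼ`.
[folklore] -/
theorem pertPoint_zero (x : σ → ℝ) (j : σ) :
    ((fun k => (x k : ℂ) + ((0 : ℝ) : ℂ) * Complex.I) + Pi.single j Complex.I : σ → ℂ) =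
      (fun k => (x k : ℂ)) + Pi.single j Complex.I := by
  funext k; simp

/-- The perturbed point `x + iε𝟙 + I eⱼ` depends continuously on `ε`. [folklore] -/
theorem continuous_pertPoint (x : σ → ℝ) (j : σ) :
    Continuous fun ε : ℝ =>
      ((fun k => (x k : ℂ) + (ε : ℂ) * Complex.I) + Pi.single j Complex.I : σ → ℂ) := by
  refine Continuous.add (continuous_pi fun k => ?_) continuous_const
  exact continuous_const.add (Complex.continuous_ofReal.mul continuous_const)

/-- Imaginary parts of the coordinates of the perturbed point `x + iε𝟙 + I eⱼ`. [folklore] -/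
theorem pertPoint_im (x : σ → ℝ) (j : σ) (ε : ℝ) (k : σ) :
    (((fun k => (x k : ℂ) + (ε : ℂ) * Complex.I) + Pi.single j Complex.I : σ → ℂ) k).im =
      ε + (if k = j then 1 else 0) := by
  by_cases hk : k = j
  · subst hk; simp
  · simp [hk]

/-- **Brändén 2007, Theorem 5.6, (2) ⇒ (1): a real stable multi-affine polynomial satisfies all
Rayleigh inequalities at every real point**: `Δᵢⱼ(f)(x) = ∂ᵢf(x)∂ⱼf(x) − ∂ᵢ∂ⱼf(x)f(x) ≥ 0` for all
`x ∈ ℝⁿ` and all `i, j`. [cite: Branden2007, §5, Theorem 5.6] -/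
theorem rayleighDiff_nonneg_of_isRealStable {f : MvPolynomial σ ℝ} (hma : IsMultiAffine f)
    (hst : IsRealStable f) (x : σ → ℝ) (i j : σ) :
    0 ≤ MvPolynomial.eval x (rayleighDiff i j f) := by
  have hval : MvPolynomial.eval x (rayleighDiff i j f) =
      eval x (pderiv i f) * eval x (pderiv j f) - eval x (pderiv i (pderiv j f)) * eval x f := by
    simp [rayleighDiff]
  rw [hval]
  -- diagonal case: `∂ᵢ∂ᵢ f = 0`
  rcases eq_or_ne i j with rfl | hij
  · rw [pderiv_pderiv_self_of_isMultiAffine hma i, map_zero, zero_mul, sub_zero]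
    exact mul_self_nonneg _
  -- the four real numbers
  set A : ℝ := eval x f with hA
  set B : ℝ := eval x (pderiv i f) with hB
  set C' : ℝ := eval x (pderiv j f) with hC
  set D : ℝ := eval x (pderiv i (pderiv j f)) with hD
  by_contra hneg
  have hneg' : B * C' - D * A < 0 := lt_of_not_ge hneg
  -- complexification
  set F : MvPolynomial σ ℂ := MvPolynomial.map (algebraMap ℝ ℂ) f with hF
  have hFma : IsMultiAffine F := isMultiAffine_map_algebraMap hma
  have hFst : IsUpperHalfPlaneStable F := hst
  have hFi : F.degreeOf i ≤ 1 := hFma i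
  have hFj : F.degreeOf j ≤ 1 := hFma j
  have hFji : (pderiv j F).degreeOf i ≤ 1 := (isMultiAffine_pderiv hFma j) i
  have hpdF : ∀ k, pderiv k F = MvPolynomial.map (algebraMap ℝ ℂ) (pderiv k f) := fun k => by
    rw [hF, pderiv_map]
  -- `α_ε = F(x + iε𝟙 + I eᵢ)`, `β_ε = ∂ⱼF(x + iε𝟙 + I eᵢ)` as opaque functions of `ε`
  obtain ⟨α, hα⟩ : ∃ α : ℝ → ℂ, ∀ ε : ℝ, α ε =
      eval ((fun k => (x k : ℂ) + (ε : ℂ) * Complex.I) + Pi.single i Complex.I) F :=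
    ⟨_, fun _ => rfl⟩
  obtain ⟨β, hβ⟩ : ∃ β : ℝ → ℂ, ∀ ε : ℝ, β ε =
      eval ((fun k => (x k : ℂ) + (ε : ℂ) * Complex.I) + Pi.single i Complex.I) (pderiv j F) :=
    ⟨_, fun _ => rfl⟩
  -- values at `ε = 0`
  have hα0 : α 0 = (A : ℂ) + Complex.I * (B : ℂ) := by
    rw [hα, pertPoint_zero, eval_add_single_eq hFi, hpdF i, eval_map_algebraMap_ofReal,
      eval_map_algebraMap_ofReal, mul_comm]
  have hβ0 : β 0 = (C' : ℂ) + Complex.I * (D : ℂ) := by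
    rw [hβ, pertPoint_zero, eval_add_single_eq hFji, hpdF j, pderiv_map,
      eval_map_algebraMap_ofReal, eval_map_algebraMap_ofReal, mul_comm]
  -- `C + iD ≠ 0` (else `BC - DA = 0`)
  have hBD : (C' : ℂ) + Complex.I * (D : ℂ) ≠ 0 := by
    intro h0
    have hre := congrArg Complex.re h0
    have him := congrArg Complex.im h0
    simp only [Complex.add_re, Complex.ofReal_re, Complex.mul_re, Complex.I_re, zero_mul,
      Complex.I_im, Complex.ofReal_im, mul_zero, sub_zero, add_zero, Complex.zero_re,
      Complex.add_im, Complex.mul_im, one_mul, zero_add, Complex.zero_im] at hre him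
    rw [hre, him] at hneg'
    simp at hneg'
  have hβ0ne : β 0 ≠ 0 := by rwa [hβ0]
  -- continuity in `ε`
  have hαc : Continuous α := by
    have : α = fun ε : ℝ =>
        eval ((fun k => (x k : ℂ) + (ε : ℂ) * Complex.I) + Pi.single i Complex.I) F := funext hα
    rw [this]
    exact (MvPolynomial.continuous_eval F).comp (continuous_pertPoint x i)
  have hβc : Continuous β := by
    have : β = fun ε : ℝ =>
        eval ((fun k => (x k : ℂ) + (ε : ℂ) * Complex.I) + Pi.single i Complex.I) (pderiv j F) :=
      funext hβ
    rw [this]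
    exact (MvPolynomial.continuous_eval (pderiv j F)).comp (continuous_pertPoint x i)
  -- the root `s_ε = -α_ε / β_ε` and its limit `s₀`
  have hs_tend : Tendsto (fun ε => -α ε / β ε) (𝓝[>] (0 : ℝ)) (𝓝 (-α 0 / β 0)) := by
    have h1 : Tendsto α (𝓝[>] (0 : ℝ)) (𝓝 (α 0)) :=
      (hαc.tendsto 0).mono_left nhdsWithin_le_nhds
    have h2 : Tendsto β (𝓝[>] (0 : ℝ)) (𝓝 (β 0)) :=
      (hβc.tendsto 0).mono_left nhdsWithin_le_nhds
    exact (h1.neg).div h2 hβ0ne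
  -- `Im s₀ = (AD - BC)/(C² + D²) > 0`
  have him0 : 0 < (-α 0 / β 0).im := by
    rw [hα0, hβ0, Complex.div_im, div_sub_div_same]
    have hnorm : 0 < Complex.normSq ((C' : ℂ) + Complex.I * (D : ℂ)) :=
      Complex.normSq_pos.mpr hBD
    refine div_pos ?_ hnorm
    simp only [Complex.neg_re, Complex.neg_im, Complex.add_re, Complex.add_im, Complex.mul_re,
      Complex.mul_im, Complex.I_re, Complex.I_im, Complex.ofReal_re, Complex.ofReal_im,
      zero_mul, mul_zero, sub_zero, one_mul, add_zero, zero_add]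
    nlinarith
  -- for small `ε > 0`: `Im s_ε > 0` and `β_ε ≠ 0`
  have hev1 : ∀ᶠ ε in 𝓝[>] (0 : ℝ), 0 < (-α ε / β ε).im :=
    ((Complex.continuous_im.tendsto _).comp hs_tend).eventually (lt_mem_nhds him0)
  have hev2 : ∀ᶠ ε in 𝓝[>] (0 : ℝ), β ε ≠ 0 :=
    ((hβc.tendsto 0).mono_left nhdsWithin_le_nhds).eventually (isOpen_ne.mem_nhds hβ0ne)
  obtain ⟨ε, ⟨hεs, hεβ⟩, hεpos⟩ := ((hev1.and hev2).and self_mem_nhdsWithin).exists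
  replace hεpos : 0 < ε := hεpos
  -- the zero of `F` in the open upper half-space
  set s₁ : ℂ := -α ε / β ε with hs₁
  have hzim : ∀ k, 0 < ((((fun k => (x k : ℂ) + (ε : ℂ) * Complex.I) + Pi.single i Complex.I) +
      Pi.single j s₁ : σ → ℂ) k).im := by
    intro k
    rw [Pi.add_apply, Complex.add_im, pertPoint_im]
    by_cases hkj : k = j
    · subst hkj
      rw [Pi.single_eq_same, if_neg hij.symm]
      linarith
    · rw [Pi.single_eq_of_ne hkj, Complex.zero_im, add_zero]
      split_ifs <;> linarith
  have hz0 : eval ((((fun k => (x k : ℂ) + (ε : ℂ) * Complex.I) + Pi.single i Complex.I) +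
      Pi.single j s₁ : σ → ℂ)) F = 0 := by
    rw [eval_add_single_eq hFj, ← hα, ← hβ, hs₁]
    field_simp
    ring
  exact hFst _ hzim hz0

end Rayleigh

end Literature.Combinatorics.StablePolynomials
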